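import Summits.ResolutionOfSingularities.ResolutionOfSingularities.Theorems.FrobeniusLadderFInjectiveMacaulayficationNewtonChartLemma
import Summits.ResolutionOfSingularities.ResolutionOfSingularities.Theorems.FrobeniusLadderFInjectiveMacaulayficationHypersurfaceRegular
import Summits.ResolutionOfSingularities.ResolutionOfSingularities.Theorems.FrobeniusLadderFInjectiveMacaulayficationFTemkinClosedPoints
import Summits.ResolutionOfSingularities.ResolutionOfSingularities.Theorems.FrobeniusLadderFInjectiveMacaulayficationDegreeZeroDescent
import Mathlib.Algebra.CharP.Algebra
import HarnessLib

/-!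
# Q8a (W-ND, the tame class rung), COROLLARY: on a unimodular chart refining the dual Newton fan, the strict transform of a Newton non-degenerate hypersurface
# is REGULAR — hence FULL — at every `k`-point lying over the origin
# (crux `FInjectiveMacaulayfication` stmt-ResolutionOfSingularities-15315, chain w45a; res-L1-w45a-plan-1 RULING R21.4 (2) «Q8a … COROLLARY: regular at every closed point of
# ⋃_S orb τ_S (Jacobian criterion) hence FullCl p there»; seat res-L1-w45a-stub-1 g12; sequel of `…NewtonChartLemma` (Ishii 1997 Lemma 4.4.24, proved there))

[OURS · L1 W4.5a] Support file (`--supports stmt-ResolutionOfSingularities-15315 --as helper`); def-free; UNCONDITIONAL; no named fact. NOT a statement of any manuscript.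
AI-written (AI review is weaker than expert review).

For `f` Newton non-degenerate, `V` unimodular with `θ_V f = Y^e·g`, `g(0) ≠ 0`, and a `k`-point `y` of the chart whose orbit lies OVER THE ORIGIN (`Σ_{i : y_i = 0} row i` strictly
positive ⟺ every `X_j = ∏_i Y_i^{V i j}` vanishes at `y`), and `Q` the prime of `k[Y]/(g)` of that point (`Q ∩ k[Y] = ker (eval y)`, so `g(y) = 0`):
* ★★ `isRegularLocalRing_of_chart` — `(k[Y]/(g))_Q` is a REGULAR local ring (`NewtonChartLemma.ishii_lemma_4_4_24` gives `∂g/∂Y_i (y) ≠ 0` for some `i`, i.e.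
  `∂g/∂Y_i ∉ Q`; Jacobian criterion `HypersurfaceRegular.stub_hypersurfaceRegularOfPderiv`, Matsumura 30.4);
* ★★ `fullCl_of_chart` — in characteristic `p`, that local ring is FULL (`FullCl p`: domain, Cohen–Macaulay clause, parameter ideals Frobenius closed;
  `FTemkinClosedPoints.fullCl_of_isRegularLocalRing`).
This is the LOCAL HALF of the tame rung (W-ND): with the global cover fact (Q8b, F-number pending at the INPUTS desk) it assembles to «every Newton non-degenerate isolated
hypersurface singularity has a point-floor cure by one monomial blowing up». [cite: IshiiSingularities2018, Lemma 4.4.24 and Thm. 4.4.23] [cite: Matsumura1987, Thm. 30.4]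
-/

-- single-problem summit: the doubled namespace component is forced
set_option linter.dupNamespace false

noncomputable section

open MvPolynomial

namespace Summit.ResolutionOfSingularities.ResolutionOfSingularities.Theorems.FInjectiveMacaulayfication.NewtonChartLemma

open Summit.ResolutionOfSingularities.ResolutionOfSingularities.Theorems.FInjectiveMacaulayfication
open Literature.AlgebraicGeometry.Resolution Literature.AlgebraicGeometry.Resolution.BoubakriGreuelMarkwig SliceableCentre

variable {k : Type} [Field k] {m : ℕ}

/-- ★★ **REGULARITY OF THE STRICT TRANSFORM OVER THE ORIGIN** (Ishii Lemma 4.4.24 + Jacobian criterion): for `f` Newton non-degenerate, `V` unimodular with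
`θ_V f = Y^e · g`, `g(0) ≠ 0`, a `k`-point `y` of the orbit `{yᵢ = 0 ⟺ i ∈ S}` lying over the origin (`Σ_{i ∈ S} row i` strictly positive), and `Q` the prime of `k[Y]/(g)` at `y`
(`Q ∩ k[Y] = ker (eval y)`), the local ring `(k[Y]/(g))_Q` is REGULAR. [cite: IshiiSingularities2018, Lemma 4.4.24 (pp. 96–97)] [cite: Matsumura1987, Thm. 30.4] -/
theorem isRegularLocalRing_of_chart (f : MvPolynomial (Fin m) k) (hND : IsNewtonNondegenerate (f : MvPowerSeries (Fin m) k))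
    (V : Matrix (Fin m) (Fin m) ℕ) (hV : IsUnit (V.map (Nat.cast : ℕ → ℤ)).det)
    (e : Fin m →₀ ℕ) (g : MvPolynomial (Fin m) k) (hθ : aeval (fun j : Fin m => ∏ i : Fin m, (X i : MvPolynomial (Fin m) k) ^ V i j) f = monomial e 1 * g)
    (hg0 : constantCoeff g ≠ 0) (S : Finset (Fin m)) (hpos : ∀ j : Fin m, 0 < ∑ i ∈ S, V i j) (y : Fin m → k) (hy : ∀ i : Fin m, y i = 0 ↔ i ∈ S)
    (Q : Ideal (MvPolynomial (Fin m) k ⧸ Ideal.span {g})) [Q.IsPrime]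
    (hQ : Q.comap (Ideal.Quotient.mk (Ideal.span {g})) = RingHom.ker (MvPolynomial.eval y)) :
    IsRegularLocalRing (Localization.AtPrime Q) := by
  have hgQ : g ∈ Q.comap (Ideal.Quotient.mk (Ideal.span {g})) := by
    rw [Ideal.mem_comap, Ideal.Quotient.eq_zero_iff_mem.mpr (Ideal.mem_span_singleton_self g)]
    exact Q.zero_mem
  have hgy : MvPolynomial.eval y g = 0 := by
    rw [hQ] at hgQ
    exact (RingHom.mem_ker).mp hgQ
  obtain ⟨i, -, hi⟩ := ishii_lemma_4_4_24 f hND V hV e g hθ hg0 S hpos y hy hgy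
  refine HypersurfaceRegular.stub_hypersurfaceRegularOfPderiv k m g i Q ?_
  rw [hQ, RingHom.mem_ker]
  exact hi

/-- ★★ **… HENCE FULL**: in characteristic `p`, at every such point the local ring of the strict transform is FULL (`FullCl p`: a domain, every system of
parameters weakly regular and generating a Frobenius closed ideal) — regular local rings are FULL (`FTemkinClosedPoints.fullCl_of_isRegularLocalRing`).
[OURS · unconditional; cite: IshiiSingularities2018, Lemma 4.4.24; Matsumura1987, Thm. 30.4] -/
theorem fullCl_of_chart (p : ℕ) [Fact p.Prime] [CharP k p] (f : MvPolynomial (Fin m) k) (hND : IsNewtonNondegenerate (f : MvPowerSeries (Fin m) k))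
    (V : Matrix (Fin m) (Fin m) ℕ) (hV : IsUnit (V.map (Nat.cast : ℕ → ℤ)).det)
    (e : Fin m →₀ ℕ) (g : MvPolynomial (Fin m) k) (hθ : aeval (fun j : Fin m => ∏ i : Fin m, (X i : MvPolynomial (Fin m) k) ^ V i j) f = monomial e 1 * g)
    (hg0 : constantCoeff g ≠ 0) (S : Finset (Fin m)) (hpos : ∀ j : Fin m, 0 < ∑ i ∈ S, V i j) (y : Fin m → k) (hy : ∀ i : Fin m, y i = 0 ↔ i ∈ S)
    (Q : Ideal (MvPolynomial (Fin m) k ⧸ Ideal.span {g})) [Q.IsPrime]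
    (hQ : Q.comap (Ideal.Quotient.mk (Ideal.span {g})) = RingHom.ker (MvPolynomial.eval y)) :
    FullCl p (Localization.AtPrime Q) := by
  haveI := isRegularLocalRing_of_chart f hND V hV e g hθ hg0 S hpos y hy Q hQ
  haveI : Nontrivial (MvPolynomial (Fin m) k ⧸ Ideal.span {g}) :=
    nontrivial_of_ne (1 : MvPolynomial (Fin m) k ⧸ Ideal.span {g}) 0 fun h10 =>
      Ideal.IsPrime.ne_top ‹_› ((Ideal.eq_top_iff_one Q).mpr (by rw [h10]; exact Q.zero_mem))
  haveI : CharP (MvPolynomial (Fin m) k ⧸ Ideal.span {g}) p :=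
    charP_of_injective_algebraMap (algebraMap k (MvPolynomial (Fin m) k ⧸ Ideal.span {g})).injective p
  haveI : CharP (Localization.AtPrime Q) p := DegreeZeroDescent.charP_localization_atPrime p Q
  exact FTemkinClosedPoints.fullCl_of_isRegularLocalRing p _

end Summit.ResolutionOfSingularities.ResolutionOfSingularities.Theorems.FInjectiveMacaulayfication.NewtonChartLemma

end
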